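import Summits.QuantumFields.BalabanUV.T4Continuum.Spine.NE2PerturbedLayer

/-!
# T⁴ programme, spine node NE2 (U1a) — THE η → 0 LIMIT COVARIANCE IS HOLOMORPHIC IN THE BACKGROUND COUPLING: `t ↦ c_∞(t)` is
# complex-differentiable on the Neumann disc `‖t‖κ < 1` (locally uniform limit of the rational functions `t ↦ c_k(t)`)

Ninth generation of the NE2 prover lineage P1 of the cell `pub-balaban`, file 12 (on top of file 4 `Spine/NE2PerturbedLayer`).
`NE2PerturbedLayer.pertCov_tendsto` gives, for every perturbation family with `PerturbationLaws … κ (C₂L^{−k})` and every coupling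
`‖t‖κ < 1`, the limit `c_∞(t)` of the King-averaged unit-lattice covariances `c_k(t)` of `(Δ_a^{(k)} + tP_k)⁻¹` with the rate bound
`‖c_k(t) − c_∞(t)‖ ≤ Cpert(t)·L^{−k}/(1 − L^{−1})`.  Since `Cpert(t)` is monotone in `‖t‖`, the convergence is UNIFORM on every
smaller disc, and each `c_k` is a rational (hence holomorphic) function of `t` there; so the limit is holomorphic:

 * §1 `pertLim P t := limUnder atTop (c_k(t))`, `tendsto_pertLim`, `norm_pertCov_sub_pertLim_le` (the rate bound for the named limit);
 * §2 `differentiableAt_pertCov` (`t ↦ c_k(t)` is differentiable at every `‖t‖κ < 1`: `Ring.inverse` at a unit, Mathlib's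
   `DifferentiableAt.inverse`, composed with the fixed sandwich `X ↦ (L^d)^k·Q^{(k)}XQ^{(k)ᴴ}` as a continuous linear map);
 * §3 `Cpert_mono` (monotone in `‖t‖`), `tendstoUniformlyOn_pertCov` on `{‖t‖ < τ}`, `τκ < 1`;
 * §4 **`differentiableOn_pertLim`**: `DifferentiableOn ℂ (pertLim P) {t | ‖t‖κ < 1}` (Mathlib's
   `TendstoLocallyUniformlyOn.differentiableOn`).  Consequence for node U3/NE5: Cauchy estimates for the background dependence of
   the limit covariance are available on every smaller disc.

HONEST FRAMING (T4-DAG p. 1).  Standard complex analysis over the results of files 1–4; the background is an abstract perturbation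
family in a global small gauge; finite torus, linear layer, operator norm; NOT infinite volume / mass gap / Clay / summit progress;
spine 0/9 unchanged.  HONEST DEPENDENCY: continuum YM on T⁴ ⇐ BetaPertH ∧ nine spine estimates (0/9 proved); BetaPertH ⇐ (D1) ∧
(D4) ∧ CAP+tail; G-an2-4 gates asym, D1 and NE2/3/4.  ABSOLUTE RULE kept; no `sorry`.
-/

noncomputable section

open scoped BigOperators ComplexConjugate Matrix Matrix.Norms.L2Operator
open Filter Topology

namespace Summit.QuantumFields.BalabanUV.T4Continuum.PerturbedLimitAnalytic

open Literature.MathematicalPhysics.QuantumFieldTheory.Balaban1983to89.B5Prop11Plancherel (Cst Cst_nonneg)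
open Summit.QuantumFields.BalabanUV.T4Continuum
open Summit.QuantumFields.BalabanUV.T4Continuum.CovariantAveragingTower (Atow avgTow)
open Summit.QuantumFields.BalabanUV.T4Continuum.BalabanAveragedTowerUnit (idx Qlev)
open Summit.QuantumFields.BalabanUV.T4Continuum.BackgroundResolventLaw (isUnit_add_smul_right)
open Summit.QuantumFields.BalabanUV.T4Continuum.BackgroundResolventTower
open Summit.QuantumFields.BalabanUV.T4Continuum.KingPairingPlantedLaw
open Summit.QuantumFields.BalabanUV.T4Continuum.NE2PerturbedLayer

variable {d : ℕ} (L : ℕ) [NeZero L] (M : Fin d → ℕ) [hM : ∀ μ, NeZero (M μ)] (a : ℝ) (ha : 0 < a)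

/-! ## §1 The named limit -/

/-- the η → 0 limit covariance at coupling `t`, as a function of `t` (`limUnder`; meaningful where the tower converges). [folklore] -/
def pertLim (P : (k : ℕ) → Matrix (idx L M k) (idx L M k) ℂ) (t : ℂ) : Matrix (idx L M 0) (idx L M 0) ℂ :=
  limUnder atTop (pertCov L M a ha P t)

/-- on the Neumann disc the tower converges to `pertLim`, with the rate bound. [folklore] -/
theorem tendsto_pertLim (hL : 2 ≤ L) {P : (k : ℕ) → Matrix (idx L M k) (idx L M k) ℂ} {κ C₂ : ℝ}
    (hpert : PerturbationLaws (calDalev L M a ha) P (JpcT L M) κ (fun k => C₂ * ((L : ℝ)⁻¹) ^ k)) {t : ℂ} (ht : ‖t‖ * κ < 1) :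
    Tendsto (pertCov L M a ha P t) atTop (𝓝 (pertLim L M a ha P t)) ∧
      ∀ k, ‖pertCov L M a ha P t k - pertLim L M a ha P t‖
        ≤ Cpert κ (2 * d * Cst d a) (CJ d a) C₂ 0 t * ((L : ℝ)⁻¹) ^ k / (1 - (L : ℝ)⁻¹) := by
  obtain ⟨c, hc, hrate⟩ := pertCov_tendsto L M a ha hL hpert ht
  have hlim : Tendsto (pertCov L M a ha P t) atTop (𝓝 (pertLim L M a ha P t)) := tendsto_nhds_limUnder ⟨c, hc⟩
  have heq : pertLim L M a ha P t = c := tendsto_nhds_unique hlim hc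
  refine ⟨hlim, fun k => ?_⟩
  rw [heq]; exact hrate k

/-! ## §2 Each level is differentiable in the coupling -/

/-- the fixed sandwich `X ↦ (L^d)^k·Q^{(k)} X Q^{(k)ᴴ}` as a linear map. [folklore] -/
def sandwichLM (k : ℕ) : Matrix (idx L M k) (idx L M k) ℂ →ₗ[ℂ] Matrix (idx L M 0) (idx L M 0) ℂ where
  toFun X := ((((L : ℝ) ^ d : ℝ) : ℂ) ^ k) • (Atow (Qlev L M) k * X * (Atow (Qlev L M) k)ᴴ)
  map_add' X Y := by rw [Matrix.mul_add, Matrix.add_mul, smul_add]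
  map_smul' c X := by rw [Matrix.mul_smul, Matrix.smul_mul, smul_comm, RingHom.id_apply]

/-- `c_k(t)` is the sandwich of the ring inverse of `Δ_a^{(k)} + tP_k`. [folklore] -/
theorem pertCov_eq_sandwich_inverse {P : (k : ℕ) → Matrix (idx L M k) (idx L M k) ℂ} (t : ℂ) (k : ℕ) :
    pertCov L M a ha P t k = sandwichLM L M k (Ring.inverse (calDalev L M a ha k + t • P k)) := by
  rw [← Matrix.nonsing_inv_eq_ringInverse]
  rfl

/-- **`t ↦ c_k(t)` IS DIFFERENTIABLE at every coupling with `‖t‖κ < 1`** (`Δ_a^{(k)} + tP_k` is a unit there). [folklore] -/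
theorem differentiableAt_pertCov {P : (k : ℕ) → Matrix (idx L M k) (idx L M k) ℂ} {κ : ℝ} {e₂ : ℕ → ℝ}
    (hpert : PerturbationLaws (calDalev L M a ha) P (JpcT L M) κ e₂) (k : ℕ) {t : ℂ} (ht : ‖t‖ * κ < 1) :
    DifferentiableAt ℂ (fun s : ℂ => pertCov L M a ha P s k) t := by
  have hfun : (fun s : ℂ => pertCov L M a ha P s k)
      = (sandwichLM L M k).toContinuousLinearMap ∘ (fun s : ℂ => Ring.inverse (calDalev L M a ha k + s • P k)) := by
    funext s
    rw [Function.comp_apply, LinearMap.coe_toContinuousLinearMap', pertCov_eq_sandwich_inverse]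
  rw [hfun]
  refine ((sandwichLM L M k).toContinuousLinearMap.differentiableAt).comp t ?_
  have hU : IsUnit (calDalev L M a ha k + t • P k) :=
    isUnit_add_smul_right (isUnit_det_calDalev L M a ha k) (hpert.opNorm_P_mul_inv_le k) ht
  have hlin : DifferentiableAt ℂ (fun s : ℂ => calDalev L M a ha k + s • P k) t :=
    (differentiableAt_const _).add (differentiableAt_id.smul_const _)
  exact hlin.inverse hU

/-! ## §3 Uniform convergence on smaller discs -/

/-- the constants are nonnegative. [folklore] -/
theorem consts_nonneg {P : (k : ℕ) → Matrix (idx L M k) (idx L M k) ℂ} {κ C₂ : ℝ}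
    (hpert : PerturbationLaws (calDalev L M a ha) P (JpcT L M) κ (fun k => C₂ * ((L : ℝ)⁻¹) ^ k)) :
    0 ≤ κ ∧ 0 ≤ C₂ := by
  refine ⟨(norm_nonneg _).trans (hpert.opNorm_P_mul_inv_le 0), ?_⟩
  have h := (norm_nonneg _).trans (hpert.consistent_le 0)
  simpa using h

/-- `Cpert(t)` is monotone in `‖t‖` on the Neumann disc (nonnegative constants, `Cf = 0`). [folklore] -/
theorem Cpert_mono {κ C₂ : ℝ} (hκ : 0 ≤ κ) (hC₂ : 0 ≤ C₂) {t : ℂ} {τ : ℝ} (htτ : ‖t‖ ≤ τ) (hτ : τ * κ < 1) :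
    Cpert κ (2 * d * Cst d a) (CJ d a) C₂ 0 t
      ≤ (CJ d a + τ * C₂) * ((1 - τ * κ)⁻¹) ^ 2 + (2 * d * Cst d a + 2 * 0) * (1 - τ * κ)⁻¹ := by
  have hC := Cst_nonneg d a
  have hCJ := CJ_nonneg d a
  have ht1 : ‖t‖ * κ ≤ τ * κ := mul_le_mul_of_nonneg_right htτ hκ
  have hν0 : 0 < 1 - τ * κ := sub_pos.mpr hτ
  have hνt : 0 < 1 - ‖t‖ * κ := by linarith
  have hν : (1 - ‖t‖ * κ)⁻¹ ≤ (1 - τ * κ)⁻¹ := by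
    rw [inv_le_inv₀ hνt hν0]; linarith
  have hνn : 0 ≤ (1 - ‖t‖ * κ)⁻¹ := inv_nonneg.mpr hνt.le
  unfold Cpert
  have hτ0 : 0 ≤ τ := (norm_nonneg t).trans htτ
  have h1 : (CJ d a + ‖t‖ * C₂) ≤ (CJ d a + τ * C₂) := by nlinarith
  have h2 : ((1 - ‖t‖ * κ)⁻¹) ^ 2 ≤ ((1 - τ * κ)⁻¹) ^ 2 := pow_le_pow_left₀ hνn hν 2
  have h3 : 0 ≤ CJ d a + τ * C₂ := add_nonneg hCJ (mul_nonneg hτ0 hC₂)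
  have h4 : 0 ≤ 2 * d * Cst d a + 2 * 0 := by positivity
  calc (CJ d a + ‖t‖ * C₂) * ((1 - ‖t‖ * κ)⁻¹) ^ 2 + (2 * d * Cst d a + 2 * 0) * (1 - ‖t‖ * κ)⁻¹
      ≤ (CJ d a + τ * C₂) * ((1 - ‖t‖ * κ)⁻¹) ^ 2 + (2 * d * Cst d a + 2 * 0) * (1 - ‖t‖ * κ)⁻¹ :=
        add_le_add (mul_le_mul_of_nonneg_right h1 (pow_nonneg hνn 2)) le_rfl
    _ ≤ (CJ d a + τ * C₂) * ((1 - τ * κ)⁻¹) ^ 2 + (2 * d * Cst d a + 2 * 0) * (1 - τ * κ)⁻¹ :=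
        add_le_add (mul_le_mul_of_nonneg_left h2 h3) (mul_le_mul_of_nonneg_left hν h4)

/-- **UNIFORM CONVERGENCE ON SMALLER DISCS**: on `{‖t‖ < τ}` with `τκ < 1`, `c_k → c_∞` uniformly. [folklore] -/
theorem tendstoUniformlyOn_pertCov (hL : 2 ≤ L) {P : (k : ℕ) → Matrix (idx L M k) (idx L M k) ℂ} {κ C₂ : ℝ}
    (hpert : PerturbationLaws (calDalev L M a ha) P (JpcT L M) κ (fun k => C₂ * ((L : ℝ)⁻¹) ^ k)) {τ : ℝ} (hτ : τ * κ < 1) :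
    TendstoUniformlyOn (fun k t => pertCov L M a ha P t k) (pertLim L M a ha P) atTop {t : ℂ | ‖t‖ < τ} := by
  obtain ⟨hκ, hC₂⟩ := consts_nonneg L M a ha hpert
  have hL1 : (1 : ℝ) < L := by exact_mod_cast (lt_of_lt_of_le one_lt_two hL : 1 < L)
  have hρ0 : (0 : ℝ) ≤ (L : ℝ)⁻¹ := inv_nonneg.mpr (Nat.cast_nonneg _)
  have hρ1 : (L : ℝ)⁻¹ < 1 := inv_lt_one_of_one_lt₀ hL1
  set B : ℝ := ((CJ d a + τ * C₂) * ((1 - τ * κ)⁻¹) ^ 2 + (2 * d * Cst d a + 2 * 0) * (1 - τ * κ)⁻¹) / (1 - (L : ℝ)⁻¹)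
    with hB
  -- the uniform bound `‖c_k(t) − c_∞(t)‖ ≤ B·ρ^k` on the disc
  have hbound : ∀ t : ℂ, ‖t‖ < τ → ∀ k, ‖pertCov L M a ha P t k - pertLim L M a ha P t‖ ≤ B * ((L : ℝ)⁻¹) ^ k := by
    intro t htτ k
    have ht : ‖t‖ * κ < 1 := lt_of_le_of_lt (mul_le_mul_of_nonneg_right htτ.le hκ) hτ
    have h1 := (tendsto_pertLim L M a ha hL hpert ht).2 k
    have h2 := Cpert_mono (d := d) a hκ hC₂ htτ.le hτ
    have hden : 0 < 1 - (L : ℝ)⁻¹ := sub_pos.mpr hρ1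
    refine h1.trans ?_
    rw [hB, div_mul_eq_mul_div]
    exact div_le_div_of_nonneg_right (mul_le_mul_of_nonneg_right h2 (pow_nonneg hρ0 k)) hden.le
  have hgeo : Tendsto (fun k : ℕ => B * ((L : ℝ)⁻¹) ^ k) atTop (𝓝 0) := by
    have := (tendsto_pow_atTop_nhds_zero_of_lt_one hρ0 hρ1).const_mul B
    simpa using this
  rw [Metric.tendstoUniformlyOn_iff]
  intro ε hε
  have hev : ∀ᶠ k in atTop, B * ((L : ℝ)⁻¹) ^ k < ε := by
    have := hgeo.eventually (gt_mem_nhds hε)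
    exact this
  filter_upwards [hev] with k hk t htτ
  rw [dist_comm, dist_eq_norm]
  exact lt_of_le_of_lt (hbound t htτ k) hk

/-! ## §4 Holomorphy of the limit on the Neumann disc -/

/-- **THE LIMIT COVARIANCE IS HOLOMORPHIC IN THE COUPLING** (`L ≥ 2`): for every perturbation family with
`PerturbationLaws … κ (C₂L^{−k})`, `t ↦ c_∞(t)` is complex-differentiable on the open Neumann disc `{‖t‖κ < 1}` (all of `ℂ` if
`κ = 0`).  Hence Cauchy estimates for the background dependence of the η → 0 limit on every smaller disc. [folklore] -/
theorem differentiableOn_pertLim (hL : 2 ≤ L) {P : (k : ℕ) → Matrix (idx L M k) (idx L M k) ℂ} {κ C₂ : ℝ}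
    (hpert : PerturbationLaws (calDalev L M a ha) P (JpcT L M) κ (fun k => C₂ * ((L : ℝ)⁻¹) ^ k)) :
    DifferentiableOn ℂ (pertLim L M a ha P) {t : ℂ | ‖t‖ * κ < 1} := by
  obtain ⟨hκ, -⟩ := consts_nonneg L M a ha hpert
  intro t₀ ht₀
  have ht₀' : ‖t₀‖ * κ < 1 := ht₀
  -- a smaller disc around `t₀` inside the Neumann disc
  obtain ⟨τ, hτt, hτ⟩ : ∃ τ : ℝ, ‖t₀‖ < τ ∧ τ * κ < 1 := by
    rcases eq_or_lt_of_le hκ with h0 | hpos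
    · exact ⟨‖t₀‖ + 1, by linarith, by rw [← h0, mul_zero]; exact zero_lt_one⟩
    · have h1 : ‖t₀‖ < κ⁻¹ := by rw [← one_div]; exact (lt_div_iff₀ hpos).mpr ht₀'
      refine ⟨(‖t₀‖ + κ⁻¹) / 2, by linarith, ?_⟩
      have e : (‖t₀‖ + κ⁻¹) / 2 * κ = (‖t₀‖ * κ + 1) / 2 := by field_simp
      rw [e]; linarith
  set V : Set ℂ := {t : ℂ | ‖t‖ < τ} with hV
  have hVopen : IsOpen V := isOpen_lt continuous_norm continuous_const
  have ht₀V : t₀ ∈ V := hτt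
  have hunif := tendstoUniformlyOn_pertCov L M a ha hL hpert hτ
  have hdiff : ∀ᶠ k in atTop, DifferentiableOn ℂ (fun t => pertCov L M a ha P t k) V :=
    Eventually.of_forall fun k => fun t htV =>
      (differentiableAt_pertCov L M a ha hpert k (lt_of_le_of_lt (mul_le_mul_of_nonneg_right (le_of_lt htV) hκ) hτ)).differentiableWithinAt
  have hD : DifferentiableOn ℂ (pertLim L M a ha P) V := hunif.tendstoLocallyUniformlyOn.differentiableOn hdiff hVopen
  exact (hD.differentiableAt (hVopen.mem_nhds ht₀V)).differentiableWithinAt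

end Summit.QuantumFields.BalabanUV.T4Continuum.PerturbedLimitAnalytic

end
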